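import Summits.BirchSwinnertonDyer.BirchSwinnertonDyer.Theorems.ByReductionTypeAtTwoTorsionEulerCharExact
import Summits.BirchSwinnertonDyer.BirchSwinnertonDyer.Theorems.ByReductionTypeAtTwoTorsionEulerCharExactOfReversePrinted
import Summits.BirchSwinnertonDyer.BirchSwinnertonDyer.Theorems.ByReductionTypeAtTwoTorsionEulerCharH46Range
import HarnessLib

set_option linter.dupNamespace false -- `…BirchSwinnertonDyer.BirchSwinnertonDyer…` is the cell's nested layout (D-0017)
set_option autoImplicit false

/-!
# Greenberg LNM 1716 Theorem 4.1 over `ℚ` WITH RATIONAL `p`-TORSION, TWO-SIDED, modulo Lemma 4.6 on `Γ`-invariants at ONE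
# auxiliary good place ALONE — the printed, `ℚ_p`, display and named-fact currencies (part 13 of the series)

Cell `bsd-2adic` (run/shared/lean/pub/bsd-2adic/), seat `bsd-2adic-tower-1` GEN 33 (re-write of GEN 32's lost parts J/K);
`--supports stmt-BirchSwinnertonDyer-19271` (helper for the GOOD-ORDINARY rows at `2` WITH a rational `2`-torsion point, whose
doors display `hEC : X5.O1.TwoAdicEulerCharRankZero W 0`, and for the non-split rows displaying
`X5.O1.TwoAdicEulerCharRankZeroNonsplitMult W 0`). THEOREMS ONLY (no definition, no named fact, no `sorry`); closes no item;
nothing booked; no display re-keyed (D-0152); BSD is not proved by any of this.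

R. Greenberg, *Iwasawa theory for elliptic curves*, LNM 1716 (1999), Thm. 4.1 (p. 102), its non-split multiplicative analogue
(pp. 112–113), Lemma 4.6 (p. 105), Lemma 4.7 (pp. 107–108). Parts 1–12 of this series make Thm. 4.1 over `ℚ` with rational
`p`-torsion a KERNEL theorem modulo ONE displayed printed input, Greenberg's Lemma 4.6 read on the `Γ`-invariant vector supported
above one auxiliary GOOD place `v₀ ∤ p`:

  «`H46(W, p, κ, v₀)`»: every `p`-primary class `z ∈ H¹(Γ_{ℚ_{v₀}}, E)` is REALISED over `ℚ_∞` by some `T ∈ H¹(ℚ_∞, E[p^∞])`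
  Selmer at every place `≠ v₀` whose local class at every place above `v₀` is `res z`.

THIS FILE states the consequences in every currency the tree consumes:

* `exists_finset_not_mem_of_good` — bookkeeping: a good `v₀ ∤ p` lies outside some finite `S ⊇ {bad} ∪ {p}`;
* **`constantCoeff_mul_sq_eq_printed_of_lemma46`** — `f(0)·#E(ℚ)(p)² = u·p^{ord_p ∏_ℓ c_ℓ}·(p^{ord_p #Ẽ(𝔽_p)})²·#Sel_{p^∞}(E/ℚ)`,
  `u ∈ ℤ_pˣ`, EVERY good ordinary `p` (`2` included), ANY rational `p`-torsion, modulo `H46` at one `v₀`;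
* **`charValue_rankZero_of_lemma46`** — the same in the EXACT `ℚ_p`-currency of `greenberg_charValue_rankZero`;
* **`twoAdicEulerCharRankZero_of_lemma46`** — `(GoodOrd W 2 → ∀ κ cyclotomic, Sel finite → ∃ good v₀ ∤ 2, H46(W,2,κ,v₀)) →
  X5.O1.TwoAdicEulerCharRankZero W 0` (the `hEC` binder of the X5.O1 α-go doors, rational `2`-torsion ALLOWED);
* **`greenberg_charValue_rankZero_of_lemma46`** — `(∀ W p good ordinary, ∀ κ cyclotomic, Sel finite → ∃ good v₀ ∤ p, H46) →
  greenberg_charValue_rankZero` (the named fact with > 600 importers; on {`E(ℚ)[p] = 0`} it is unconditional since k4-p1);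
* **`constantCoeff_mul_sq_eq_two_nonsplit_of_lemma46`**, **`twoAdicEulerCharRankZeroNonsplitMult_of_lemma46`** — the NON-SPLIT
  multiplicative twins (`f(0)·#E(ℚ)(2)² = u·2^{ord₂ ∏_ℓ c_ℓ + 1}·#Sel`, `u ∈ ℤ₂ˣ`; the display `…NonsplitMult W 0`);
* `twoAdicEulerCharRankZero_of_lemma46_torsion`, `greenberg_charValue_rankZero_of_lemma46_torsion` — the same with the `H46`
  supply demanded ONLY where `#E(ℚ)(p) ≠ 1` (part 15 `…H46Range`: `H46` holds outright when `#E(ℚ)(p) = 1`).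

HONEST FRAMING: `H46` is NOT proved here (Greenberg's Lemma 4.6 on `Γ`-invariants; XL in the tree: twists `A_s` + Prop. 4.13
over the layers, or Λ-adic Poitou–Tate — the tree's Poitou–Tate fact lives at the level of a `NumberField`, not of the layers
`ℚ_n ⊂ ℚ_∞`); it is a DISPLAYED binder in D-0152 shape, not a named fact (RC-441 (b)). Everything else is kernel-checked over
tree theorems. Closes no item; no summit statement is proved; the Birch–Swinnerton-Dyer conjecture is NOT proved by any of this.

References: [GreenbergLNM1716] Thm. 4.1 (p. 102), §3 Lemmas 3.3–3.4 (pp. 86–89), §4 pp. 104–108, pp. 112–113.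
-/

noncomputable section

open scoped Classical NumberField

open NumberField IsDedekindDomain Field

namespace Summit.BirchSwinnertonDyer.BirchSwinnertonDyer.Theorems.TorsionEulerChar

open Literature.NumberTheory.EllipticCurves Literature.NumberTheory.GaloisRepresentations
  WeierstrassCurve ZpExtension Literature.NumberTheory.EllipticCurves.IwasawaAlgebra
  Literature.NumberTheory.EllipticCurves.IwasawaDual
  Literature.NumberTheory.EllipticCurves.GreenbergVatsal2000 Literature.NumberTheory.EllipticCurves.GreenbergSelmer
  Literature.NumberTheory.EllipticCurves.Rank1Residual Summit.BirchSwinnertonDyer.Rank1Residual.X2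

/-! ## §0 Bookkeeping: a good place `v₀ ∤ p` lies outside some `S ⊇ {bad} ∪ {p}` -/

/-- **A good place `v₀ ∤ p` lies outside a finite `S ⊇ {bad} ∪ {v ∣ p}`** (`S` := bad ∪ {v ∣ p}; the bad places are finite,
Silverman VIII.1.3 / tree `eventually_hasGoodReductionAt`; the places above `p` are finite). [cite: SilvermanAEC2009, Rem. VIII.1.3] -/
theorem exists_finset_not_mem_of_good (W : WeierstrassCurve ℚ) [W.IsElliptic] (p : ℕ) [hp : Fact p.Prime]
    (v₀ : HeightOneSpectrum (𝓞 ℚ)) (hpv₀ : ((p : ℕ) : 𝓞 ℚ) ∉ v₀.asIdeal) (hgood₀ : W.HasGoodReductionAt v₀) :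
    ∃ S : Finset (HeightOneSpectrum (𝓞 ℚ)),
      (∀ v ∉ S, ((p : ℕ) : 𝓞 ℚ) ∉ v.asIdeal ∧ W.HasGoodReductionAt v) ∧ v₀ ∉ S := by
  -- adapted from `exists_finset_place` (GEN 31 part 6)
  have hbadfin : {v : HeightOneSpectrum (𝓞 ℚ) | ¬ W.HasGoodReductionAt v}.Finite := by
    have h := W.eventually_hasGoodReductionAt
    rwa [Filter.eventually_cofinite] at h
  have hp0 : (Ideal.span {((p : ℕ) : 𝓞 ℚ)} : Ideal (𝓞 ℚ)) ≠ 0 := by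
    rw [Ne, Ideal.zero_eq_bot, Ideal.span_singleton_eq_bot]
    exact_mod_cast hp.out.ne_zero
  have hpfin : {v : HeightOneSpectrum (𝓞 ℚ) | ((p : ℕ) : 𝓞 ℚ) ∈ v.asIdeal}.Finite := by
    refine (Ideal.finite_factors hp0).subset fun v hv ↦ ?_
    exact (Ideal.dvd_span_singleton).mpr hv
  refine ⟨hbadfin.toFinset ∪ hpfin.toFinset, fun v hv ↦ ⟨fun h ↦ hv ?_, by_contra fun h ↦ hv ?_⟩, fun h ↦ ?_⟩
  · exact Finset.mem_union_right _ (hpfin.mem_toFinset.mpr h)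
  · exact Finset.mem_union_left _ (hbadfin.mem_toFinset.mpr h)
  · rcases Finset.mem_union.mp h with h | h
    · exact (hbadfin.mem_toFinset.mp h) hgood₀
    · exact hpv₀ (hpfin.mem_toFinset.mp h)

/-! ## §1 Good ordinary `p`: the printed and `ℚ_p` currencies modulo `H46` at one place -/

/-- **Greenberg's Thm. 4.1 over `ℚ`, PRINTED SHAPE, TWO-SIDED, EVERY good ordinary `p` (`2` included), ANY rational
`p`-torsion, modulo `H46` at ONE auxiliary good place `v₀ ∤ p`:** for `W/ℚ` globally minimal and elliptic with `GoodOrd W p`,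
`κ` cyclotomic with topological generator `γ`, `D` a dual datum with `char X = (f)` and `Sel_{p^∞}(E/ℚ)` finite: `X` is finitely
generated `Λ`-torsion and **`f(0) · #E(ℚ)(p)² = u · p^{ord_p ∏_ℓ c_ℓ} · (p^{ord_p #Ẽ(𝔽_p)})² · #Sel_{p^∞}(E/ℚ)`, `u ∈ ℤ_pˣ`**
— EXACTLY the printed display. [cite: GreenbergLNM1716, Thm. 4.1 (p. 102), §4 Lemmas 4.6–4.7 (pp. 105–108)] -/
theorem constantCoeff_mul_sq_eq_printed_of_lemma46 (p : ℕ) [hp : Fact p.Prime] (W : WeierstrassCurve ℚ)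
    [W.IsGloballyMinimal] [W.IsElliptic] (hgo : GoodOrd W p) (κ : ZpExtension ℚ p) (hκ : κ.IsCyclotomic)
    {γ : absoluteGaloisGroup ℚ} (hγ : κ.IsTopGenerator γ) (D : W.SelmerDualData κ γ) [Finite (W.selmerGroupPInfty p)]
    (v₀ : HeightOneSpectrum (𝓞 ℚ)) (hpv₀ : ((p : ℕ) : 𝓞 ℚ) ∉ v₀.asIdeal) (hgood₀ : W.HasGoodReductionAt v₀)
    (h46 : ∀ z : discreteH1 (localSubgroup (⊤ : Subgroup (absoluteGaloisGroup ℚ)) (v₀.adicCompletion ℚ))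
        (localPoints W (v₀.adicCompletion ℚ)), (∃ k : ℕ, p ^ k • z = 0) →
      ∃ T : W.subgroupH1 p κ.kerSubgroup,
        (∀ v : HeightOneSpectrum (𝓞 ℚ), v ≠ v₀ → ∀ σ : absoluteGaloisGroup ℚ,
          W.conjH1 p κ.kerSubgroup σ T ∈ W.localKerOver p κ.kerSubgroup (v.adicCompletion ℚ)) ∧
        (∀ (w : InfinitePlace ℚ) (σ : absoluteGaloisGroup ℚ),
          W.conjH1 p κ.kerSubgroup σ T ∈ W.localKerOver p κ.kerSubgroup w.Completion) ∧
        ∀ σ : absoluteGaloisGroup ℚ,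
          W.localResOver p κ.kerSubgroup (v₀.adicCompletion ℚ) (W.conjH1 p κ.kerSubgroup σ T) =
            Literature.NumberTheory.EllipticCurves.resOfLe (localPoints W (v₀.adicCompletion ℚ))
              (Subgroup.comap_mono le_top :
                localSubgroup κ.kerSubgroup (v₀.adicCompletion ℚ) ≤
                  localSubgroup (⊤ : Subgroup (absoluteGaloisGroup ℚ)) (v₀.adicCompletion ℚ)) z)
    (f : IwasawaAlgebra p) (hf : Module.charIdeal (IwasawaAlgebra p) D.X = Ideal.span {f}) :
    Module.Finite (IwasawaAlgebra p) D.X ∧ Module.IsTorsion (IwasawaAlgebra p) D.X ∧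
      ∃ u : ℤ_[p]ˣ, PowerSeries.constantCoeff f *
          (Nat.card (AddCommGroup.primaryComponent W.toAffine.Point p) : ℤ_[p]) ^ 2 =
        (u : ℤ_[p]) * (p ^ padicValNat p W.tamagawaProduct : ℕ) * ((p ^ padicValNat p (W.reductionPointCount p)) ^ 2 : ℕ) *
          Nat.card (W.selmerGroupPInfty p) := by
  have hord : IsOrdinaryAt W p := hgo
  obtain ⟨S, hS, hv₀⟩ := exists_finset_not_mem_of_good W p v₀ hpv₀ hgood₀
  exact constantCoeff_mul_sq_eq_printed_of_reverse p W hgo κ hκ hγ D S hS v₀ hv₀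
    (reverse_of_lemma46_rat p W κ hγ D (fun v hpv ↦ (InputsGreenbergLemma34.lemma34_rat_zero W p hord κ hκ v hpv).1)
      S hS v₀ hv₀ h46 f hf) f hf

/-- **The TWO-SIDED display in the EXACT currency of the named fact `greenberg_charValue_rankZero` (and, at `p = 2`, of
`X5.O1.TwoAdicEulerCharRankZero W 0`), modulo `H46` at ONE auxiliary good place `v₀ ∤ p` ALONE:** `∃ u ∈ ℤ_pˣ`,
**`fE(0) · #E(ℚ)(p)² = u · p^{ord_p ∏_ℓ c_ℓ} · #Ẽ(𝔽_p)(p)² · #Sel_{p^∞}(E/ℚ)`** in `ℚ_p` — NO hypothesis on `E(ℚ)[p]`, no `p ≠ 2`.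
[cite: GreenbergLNM1716, Thm. 4.1 (p. 102), §4 Lemmas 4.6–4.7 (pp. 105–108)] -/
theorem charValue_rankZero_of_lemma46 (p : ℕ) [hp : Fact p.Prime] (W : WeierstrassCurve ℚ)
    [W.IsGloballyMinimal] [W.IsElliptic] (hgo : GoodOrd W p) (κ : ZpExtension ℚ p) (hκ : κ.IsCyclotomic)
    {γ : absoluteGaloisGroup ℚ} (hγ : κ.IsTopGenerator γ) (D : W.SelmerDualData κ γ) [Finite (W.selmerGroupPInfty p)]
    (v₀ : HeightOneSpectrum (𝓞 ℚ)) (hpv₀ : ((p : ℕ) : 𝓞 ℚ) ∉ v₀.asIdeal) (hgood₀ : W.HasGoodReductionAt v₀)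
    (h46 : ∀ z : discreteH1 (localSubgroup (⊤ : Subgroup (absoluteGaloisGroup ℚ)) (v₀.adicCompletion ℚ))
        (localPoints W (v₀.adicCompletion ℚ)), (∃ k : ℕ, p ^ k • z = 0) →
      ∃ T : W.subgroupH1 p κ.kerSubgroup,
        (∀ v : HeightOneSpectrum (𝓞 ℚ), v ≠ v₀ → ∀ σ : absoluteGaloisGroup ℚ,
          W.conjH1 p κ.kerSubgroup σ T ∈ W.localKerOver p κ.kerSubgroup (v.adicCompletion ℚ)) ∧
        (∀ (w : InfinitePlace ℚ) (σ : absoluteGaloisGroup ℚ),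
          W.conjH1 p κ.kerSubgroup σ T ∈ W.localKerOver p κ.kerSubgroup w.Completion) ∧
        ∀ σ : absoluteGaloisGroup ℚ,
          W.localResOver p κ.kerSubgroup (v₀.adicCompletion ℚ) (W.conjH1 p κ.kerSubgroup σ T) =
            Literature.NumberTheory.EllipticCurves.resOfLe (localPoints W (v₀.adicCompletion ℚ))
              (Subgroup.comap_mono le_top :
                localSubgroup κ.kerSubgroup (v₀.adicCompletion ℚ) ≤
                  localSubgroup (⊤ : Subgroup (absoluteGaloisGroup ℚ)) (v₀.adicCompletion ℚ)) z)
    (fE : IwasawaAlgebra p) (hf : D.charIdeal = Ideal.span {fE}) :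
    ∃ u : ℤ_[p]ˣ,
      ((PowerSeries.constantCoeff fE : ℤ_[p]) : ℚ_[p]) *
          (Nat.card (AddCommGroup.primaryComponent W.toAffine.Point p) : ℚ_[p]) ^ 2 =
        ((u : ℤ_[p]) : ℚ_[p]) * (p : ℚ_[p]) ^ (padicValNat p W.tamagawaProduct) *
          (Nat.card (AddCommGroup.primaryComponent
            ((integralModelInt W).map (Int.castRingHom (ZMod p))).toAffine.Point p) : ℚ_[p]) ^ 2 *
          (Nat.card (W.selmerGroupPInfty p) : ℚ_[p]) := by
  have hord : IsOrdinaryAt W p := hgo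
  obtain ⟨S, hS, hv₀⟩ := exists_finset_not_mem_of_good W p v₀ hpv₀ hgood₀
  exact charValue_rankZero_of_reverse p W hgo κ hκ hγ D S hS v₀ hv₀
    (reverse_of_lemma46_rat p W κ hγ D (fun v hpv ↦ (InputsGreenbergLemma34.lemma34_rat_zero W p hord κ hκ v hpv).1)
      S hS v₀ hv₀ h46 fE hf) fE hf

/-! ## §2 `p = 2`: the display `X5.O1.TwoAdicEulerCharRankZero W 0`; every good ordinary `p`: the named fact -/

open Summit.BirchSwinnertonDyer.Rank1Residual.X5.O1 in
/-- **`hEC` modulo Lemma 4.6 on `Γ`-invariants at one place, rational `2`-torsion ALLOWED.** For `W/ℚ` globally minimal and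
elliptic: if, at the good ordinary `2`, for every cyclotomic `ℤ₂`-extension `κ` and finite `Sel_{2^∞}(E/ℚ)` there is a GOOD place
`v₀ ∤ 2` with `H46(W, 2, κ, v₀)`, then Greenberg's rank-`0` Euler-characteristic formula at `2` holds in the tree's display shape
`TwoAdicEulerCharRankZero W 0` (the `hEC` binder of the X5.O1 α-go doors). On {`E(ℚ)[2] = 0`} the display is unconditional
(GEN 25 `GreenbergEulerChar.twoAdicEulerCharRankZero_of_noTwoTorsion`); `H46` itself holds outright when `#E(ℚ)(2) = 1`
(part 15, `…H46Range`). [cite: GreenbergLNM1716, Thm. 4.1 (p. 102), §4 Lemmas 4.6–4.7 (pp. 105–108)] -/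
theorem twoAdicEulerCharRankZero_of_lemma46 (W : WeierstrassCurve ℚ) [W.IsElliptic] [W.IsGloballyMinimal]
    (h46 : GoodOrd W 2 → ∀ κ : ZpExtension ℚ 2, κ.IsCyclotomic → Finite (W.selmerGroupPInfty 2) →
      ∃ v₀ : HeightOneSpectrum (𝓞 ℚ), ((2 : ℕ) : 𝓞 ℚ) ∉ v₀.asIdeal ∧ W.HasGoodReductionAt v₀ ∧
        ∀ z : discreteH1 (localSubgroup (⊤ : Subgroup (absoluteGaloisGroup ℚ)) (v₀.adicCompletion ℚ))
          (localPoints W (v₀.adicCompletion ℚ)), (∃ k : ℕ, 2 ^ k • z = 0) →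
        ∃ T : W.subgroupH1 2 κ.kerSubgroup,
          (∀ v : HeightOneSpectrum (𝓞 ℚ), v ≠ v₀ → ∀ σ : absoluteGaloisGroup ℚ,
            W.conjH1 2 κ.kerSubgroup σ T ∈ W.localKerOver 2 κ.kerSubgroup (v.adicCompletion ℚ)) ∧
          (∀ (w : InfinitePlace ℚ) (σ : absoluteGaloisGroup ℚ),
            W.conjH1 2 κ.kerSubgroup σ T ∈ W.localKerOver 2 κ.kerSubgroup w.Completion) ∧
          ∀ σ : absoluteGaloisGroup ℚ,
            W.localResOver 2 κ.kerSubgroup (v₀.adicCompletion ℚ) (W.conjH1 2 κ.kerSubgroup σ T) =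
              Literature.NumberTheory.EllipticCurves.resOfLe (localPoints W (v₀.adicCompletion ℚ))
                (Subgroup.comap_mono le_top :
                  localSubgroup κ.kerSubgroup (v₀.adicCompletion ℚ) ≤
                    localSubgroup (⊤ : Subgroup (absoluteGaloisGroup ℚ)) (v₀.adicCompletion ℚ)) z) :
    TwoAdicEulerCharRankZero W 0 := by
  intro hord κ γ hκ hγ _ D _ _ fE hfE hSel
  haveI := hSel
  have hgo : GoodOrd W 2 := hord
  obtain ⟨v₀, hpv₀, hgood₀, h⟩ := h46 hgo κ hκ hSel
  obtain ⟨u, hu⟩ := charValue_rankZero_of_lemma46 2 W hgo κ hκ hγ D v₀ hpv₀ hgood₀ h fE hfE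
  refine ⟨u, ?_⟩
  rw [hu, add_zero, zpow_natCast, Nat.cast_ofNat]

/-- **The named fact `greenberg_charValue_rankZero` (Greenberg's Thm. 4.1 over `ℚ`, rank `0`, every odd good ordinary `p`, ANY
rational `p`-torsion) FOLLOWS from Lemma 4.6 on `Γ`-invariants at one auxiliary good place** — i.e. from
`∀ W p` (good ordinary, `κ` cyclotomic, `Sel_{p^∞}(E/ℚ)` finite) `∃` good `v₀ ∤ p` with `H46(W, p, κ, v₀)`. On {`E(ℚ)[p] = 0`} the
fact is already unconditional (k4-p1 `InputsGreenbergLemma34.constantCoeff_charGenerator_eq_printed`); `H46` holds outright when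
`#E(ℚ)(p) = 1` (part 15). [cite: GreenbergLNM1716, Thm. 4.1 (p. 102), §4 Lemmas 4.6–4.7 (pp. 105–108)] -/
theorem greenberg_charValue_rankZero_of_lemma46
    (h46 : ∀ (W : WeierstrassCurve ℚ) [W.IsElliptic] [W.IsGloballyMinimal] (p : ℕ) [Fact p.Prime],
      GoodOrd W p → ∀ κ : ZpExtension ℚ p, κ.IsCyclotomic → Finite (W.selmerGroupPInfty p) →
      ∃ v₀ : HeightOneSpectrum (𝓞 ℚ), ((p : ℕ) : 𝓞 ℚ) ∉ v₀.asIdeal ∧ W.HasGoodReductionAt v₀ ∧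
        ∀ z : discreteH1 (localSubgroup (⊤ : Subgroup (absoluteGaloisGroup ℚ)) (v₀.adicCompletion ℚ))
          (localPoints W (v₀.adicCompletion ℚ)), (∃ k : ℕ, p ^ k • z = 0) →
        ∃ T : W.subgroupH1 p κ.kerSubgroup,
          (∀ v : HeightOneSpectrum (𝓞 ℚ), v ≠ v₀ → ∀ σ : absoluteGaloisGroup ℚ,
            W.conjH1 p κ.kerSubgroup σ T ∈ W.localKerOver p κ.kerSubgroup (v.adicCompletion ℚ)) ∧
          (∀ (w : InfinitePlace ℚ) (σ : absoluteGaloisGroup ℚ),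
            W.conjH1 p κ.kerSubgroup σ T ∈ W.localKerOver p κ.kerSubgroup w.Completion) ∧
          ∀ σ : absoluteGaloisGroup ℚ,
            W.localResOver p κ.kerSubgroup (v₀.adicCompletion ℚ) (W.conjH1 p κ.kerSubgroup σ T) =
              Literature.NumberTheory.EllipticCurves.resOfLe (localPoints W (v₀.adicCompletion ℚ))
                (Subgroup.comap_mono le_top :
                  localSubgroup κ.kerSubgroup (v₀.adicCompletion ℚ) ≤
                    localSubgroup (⊤ : Subgroup (absoluteGaloisGroup ℚ)) (v₀.adicCompletion ℚ)) z) :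
    greenberg_charValue_rankZero := by
  intro W _ _ p _ _ hgood hord κ γ hκ hγ _ D _ _ fE hfE hSel
  haveI := hSel
  have hgo : GoodOrd W p := ⟨hgood, hord⟩
  obtain ⟨v₀, hpv₀, hgood₀, h⟩ := h46 W p hgo κ hκ hSel
  exact charValue_rankZero_of_lemma46 p W hgo κ hκ hγ D v₀ hpv₀ hgood₀ h fE hfE

/-! ## §3 The NON-SPLIT multiplicative twins -/

/-- **The TWO-SIDED display at a NON-SPLIT `2`, ANY rational `2`-torsion, modulo `H46` at ONE auxiliary good place `v₀ ∤ 2`:**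
for `W/ℚ` globally minimal and elliptic, non-split multiplicative at `2`, `κ` cyclotomic with topological generator `γ`,
`Sel_{2^∞}(E/ℚ)` finite, `D` a dual datum with `char X = (f)`: **`f(0) · #E(ℚ)(2)² = u · 2^{ord₂ ∏_ℓ c_ℓ + 1} · #Sel_{2^∞}(E/ℚ)`,
`u ∈ ℤ₂ˣ`** — EXACTLY the printed display «If p = 2, then |ker(r_v)| = 2c_v^{(p)}» (the unit form of GEN 31 part 6).
[cite: GreenbergLNM1716, §4 pp. 112–113, §3 p. 93, Lemmas 4.6–4.7 (pp. 105–108)] -/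
theorem constantCoeff_mul_sq_eq_two_nonsplit_of_lemma46 (W : WeierstrassCurve ℚ) [W.IsGloballyMinimal] [W.IsElliptic]
    (hmult : W.HasMultiplicativeReductionAtPrime 2) (hns : ¬ W.HasSplitMultiplicativeReductionAtPrime 2)
    (κ : ZpExtension ℚ 2) (hκ : κ.IsCyclotomic) {γ : absoluteGaloisGroup ℚ} (hγ : κ.IsTopGenerator γ)
    (D : W.SelmerDualData κ γ) [Finite (W.selmerGroupPInfty 2)]
    (v₀ : HeightOneSpectrum (𝓞 ℚ)) (hpv₀ : ((2 : ℕ) : 𝓞 ℚ) ∉ v₀.asIdeal) (hgood₀ : W.HasGoodReductionAt v₀)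
    (h46 : ∀ z : discreteH1 (localSubgroup (⊤ : Subgroup (absoluteGaloisGroup ℚ)) (v₀.adicCompletion ℚ))
        (localPoints W (v₀.adicCompletion ℚ)), (∃ k : ℕ, 2 ^ k • z = 0) →
      ∃ T : W.subgroupH1 2 κ.kerSubgroup,
        (∀ v : HeightOneSpectrum (𝓞 ℚ), v ≠ v₀ → ∀ σ : absoluteGaloisGroup ℚ,
          W.conjH1 2 κ.kerSubgroup σ T ∈ W.localKerOver 2 κ.kerSubgroup (v.adicCompletion ℚ)) ∧
        (∀ (w : InfinitePlace ℚ) (σ : absoluteGaloisGroup ℚ),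
          W.conjH1 2 κ.kerSubgroup σ T ∈ W.localKerOver 2 κ.kerSubgroup w.Completion) ∧
        ∀ σ : absoluteGaloisGroup ℚ,
          W.localResOver 2 κ.kerSubgroup (v₀.adicCompletion ℚ) (W.conjH1 2 κ.kerSubgroup σ T) =
            Literature.NumberTheory.EllipticCurves.resOfLe (localPoints W (v₀.adicCompletion ℚ))
              (Subgroup.comap_mono le_top :
                localSubgroup κ.kerSubgroup (v₀.adicCompletion ℚ) ≤
                  localSubgroup (⊤ : Subgroup (absoluteGaloisGroup ℚ)) (v₀.adicCompletion ℚ)) z)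
    (f : IwasawaAlgebra 2) (hf : Module.charIdeal (IwasawaAlgebra 2) D.X = Ideal.span {f}) :
    Module.Finite (IwasawaAlgebra 2) D.X ∧ Module.IsTorsion (IwasawaAlgebra 2) D.X ∧
      ∃ u : ℤ_[2]ˣ, PowerSeries.constantCoeff f *
          (Nat.card (AddCommGroup.primaryComponent W.toAffine.Point 2) : ℤ_[2]) ^ 2 =
        (u : ℤ_[2]) * (2 ^ (padicValNat 2 W.tamagawaProduct + 1) : ℕ) * Nat.card (W.selmerGroupPInfty 2) := by
  obtain ⟨S, hS, hv₀⟩ := exists_finset_not_mem_of_good W 2 v₀ hpv₀ hgood₀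
  exact constantCoeff_mul_sq_eq_two_nonsplit_of_reverse W hmult hns κ hκ hγ D S hS v₀ hv₀
    (reverse_of_lemma46_rat 2 W κ hγ D (fun v hpv ↦ by
      obtain ⟨B, hB⟩ := MultTowerControl.exists_natCard_localTowerKerPrimary_le_multiplicative W hmult κ hκ v hpv
      exact (hB 0).1) S hS v₀ hv₀ h46 f hf) f hf

open Summit.BirchSwinnertonDyer.Rank1Residual.X5.O1 in
/-- **The display `X5.O1.TwoAdicEulerCharRankZeroNonsplitMult W 0` modulo Lemma 4.6 on `Γ`-invariants at one place, rational
`2`-torsion ALLOWED:** if at the non-split multiplicative `2`, for every cyclotomic `κ` and finite `Sel_{2^∞}(E/ℚ)`, there is a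
good `v₀ ∤ 2` with `H46(W, 2, κ, v₀)`, then Greenberg's «analogue of Thm. 4.1» at `2` holds in the tree's display shape. On
{`E(ℚ)[2] = 0`} the display is unconditional (GEN 30); `H46` holds outright when `#E(ℚ)(2) = 1` (part 15).
[cite: GreenbergLNM1716, §4 pp. 112–113; §3 p. 93; Lemmas 4.6–4.7 (pp. 105–108)] -/
theorem twoAdicEulerCharRankZeroNonsplitMult_of_lemma46 (W : WeierstrassCurve ℚ) [W.IsElliptic] [W.IsGloballyMinimal]
    (h46 : W.HasMultiplicativeReductionAtPrime 2 → ¬ W.HasSplitMultiplicativeReductionAtPrime 2 →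
      ∀ κ : ZpExtension ℚ 2, κ.IsCyclotomic → Finite (W.selmerGroupPInfty 2) →
      ∃ v₀ : HeightOneSpectrum (𝓞 ℚ), ((2 : ℕ) : 𝓞 ℚ) ∉ v₀.asIdeal ∧ W.HasGoodReductionAt v₀ ∧
        ∀ z : discreteH1 (localSubgroup (⊤ : Subgroup (absoluteGaloisGroup ℚ)) (v₀.adicCompletion ℚ))
          (localPoints W (v₀.adicCompletion ℚ)), (∃ k : ℕ, 2 ^ k • z = 0) →
        ∃ T : W.subgroupH1 2 κ.kerSubgroup,
          (∀ v : HeightOneSpectrum (𝓞 ℚ), v ≠ v₀ → ∀ σ : absoluteGaloisGroup ℚ,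
            W.conjH1 2 κ.kerSubgroup σ T ∈ W.localKerOver 2 κ.kerSubgroup (v.adicCompletion ℚ)) ∧
          (∀ (w : InfinitePlace ℚ) (σ : absoluteGaloisGroup ℚ),
            W.conjH1 2 κ.kerSubgroup σ T ∈ W.localKerOver 2 κ.kerSubgroup w.Completion) ∧
          ∀ σ : absoluteGaloisGroup ℚ,
            W.localResOver 2 κ.kerSubgroup (v₀.adicCompletion ℚ) (W.conjH1 2 κ.kerSubgroup σ T) =
              Literature.NumberTheory.EllipticCurves.resOfLe (localPoints W (v₀.adicCompletion ℚ))
                (Subgroup.comap_mono le_top :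
                  localSubgroup κ.kerSubgroup (v₀.adicCompletion ℚ) ≤
                    localSubgroup (⊤ : Subgroup (absoluteGaloisGroup ℚ)) (v₀.adicCompletion ℚ)) z) :
    TwoAdicEulerCharRankZeroNonsplitMult W 0 := by
  intro hmult hns κ γ hκ hγ _ D _ _ fE hfE hSel
  haveI := hSel
  obtain ⟨v₀, hpv₀, hgood₀, h⟩ := h46 hmult hns κ hκ hSel
  obtain ⟨-, -, u, hu⟩ := constantCoeff_mul_sq_eq_two_nonsplit_of_lemma46 W hmult hns κ hκ hγ D v₀ hpv₀ hgood₀ h fE hfE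
  refine ⟨u, ?_⟩
  have h2 : ((2 : ℤ_[2]) : ℚ_[2]) = 2 := rfl
  have h := congrArg ((↑) : ℤ_[2] → ℚ_[2]) hu
  push_cast at h
  rw [h, add_zero, zpow_natCast]
  simp only [h2]

/-! ## §4 Sharpening by part 15: the supply of `H46` is needed only where `E(ℚ)` HAS rational `p`-torsion -/

open Summit.BirchSwinnertonDyer.Rank1Residual.X5.O1 in
/-- **`hEC` modulo `H46` ON THE TORSION LOCUS ONLY.** For `W/ℚ` globally minimal and elliptic: if `H46(W, 2, κ, v₀)` is supplied
(at some good `v₀ ∤ 2`, for every cyclotomic `κ`) only in case `#E(ℚ)(2) ≠ 1`, the display `TwoAdicEulerCharRankZero W 0` holds —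
when `#E(ℚ)(2) = 1` part 15 (`exists_realizer_of_natCard_primaryComponent_eq_one`: Cassels' cokernel at `v₀` is trivial)
supplies `H46` outright. [cite: GreenbergLNM1716, Thm. 4.1 (p. 102), §4 p. 104, Lemmas 4.6–4.7 (pp. 105–108)] -/
theorem twoAdicEulerCharRankZero_of_lemma46_torsion (W : WeierstrassCurve ℚ) [W.IsElliptic] [W.IsGloballyMinimal]
    (h46 : GoodOrd W 2 → Nat.card (AddCommGroup.primaryComponent W.toAffine.Point 2) ≠ 1 →
      ∀ κ : ZpExtension ℚ 2, κ.IsCyclotomic → Finite (W.selmerGroupPInfty 2) →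
      ∃ v₀ : HeightOneSpectrum (𝓞 ℚ), ((2 : ℕ) : 𝓞 ℚ) ∉ v₀.asIdeal ∧ W.HasGoodReductionAt v₀ ∧
        ∀ z : discreteH1 (localSubgroup (⊤ : Subgroup (absoluteGaloisGroup ℚ)) (v₀.adicCompletion ℚ))
          (localPoints W (v₀.adicCompletion ℚ)), (∃ k : ℕ, 2 ^ k • z = 0) →
        ∃ T : W.subgroupH1 2 κ.kerSubgroup,
          (∀ v : HeightOneSpectrum (𝓞 ℚ), v ≠ v₀ → ∀ σ : absoluteGaloisGroup ℚ,
            W.conjH1 2 κ.kerSubgroup σ T ∈ W.localKerOver 2 κ.kerSubgroup (v.adicCompletion ℚ)) ∧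
          (∀ (w : InfinitePlace ℚ) (σ : absoluteGaloisGroup ℚ),
            W.conjH1 2 κ.kerSubgroup σ T ∈ W.localKerOver 2 κ.kerSubgroup w.Completion) ∧
          ∀ σ : absoluteGaloisGroup ℚ,
            W.localResOver 2 κ.kerSubgroup (v₀.adicCompletion ℚ) (W.conjH1 2 κ.kerSubgroup σ T) =
              Literature.NumberTheory.EllipticCurves.resOfLe (localPoints W (v₀.adicCompletion ℚ))
                (Subgroup.comap_mono le_top :
                  localSubgroup κ.kerSubgroup (v₀.adicCompletion ℚ) ≤
                    localSubgroup (⊤ : Subgroup (absoluteGaloisGroup ℚ)) (v₀.adicCompletion ℚ)) z) :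
    TwoAdicEulerCharRankZero W 0 := by
  refine twoAdicEulerCharRankZero_of_lemma46 W fun hgo κ hκ hSel ↦ ?_
  have hdec : (fun a b : ℚ => Classical.propDecidable (a = b)) = instDecidableEqRat := Subsingleton.elim _ _
  by_cases hE : Nat.card (AddCommGroup.primaryComponent W.toAffine.Point 2) = 1
  · haveI := hSel
    obtain ⟨S, v₀, hS, hv₀⟩ := exists_finset_place W 2
    refine ⟨v₀, (hS v₀ hv₀).1, (hS v₀ hv₀).2, fun z hz ↦ ?_⟩
    exact exists_realizer_of_natCard_primaryComponent_eq_one W 2 κ (by rw [hdec]; exact hE) S hS v₀ hv₀ z hz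
  · exact h46 hgo hE κ hκ hSel

/-- **`greenberg_charValue_rankZero` modulo `H46` ON THE TORSION LOCUS ONLY**: the named fact follows from a supply of
`H46(W, p, κ, v₀)` (some good `v₀ ∤ p`, every cyclotomic `κ`) for the pairs `(W, p)` with `GoodOrd W p` AND `#E(ℚ)(p) ≠ 1` — a locus
with `p ≤ 7` by Mazur's torsion theorem; on `#E(ℚ)(p) = 1` part 15 supplies `H46` (and k4-p1 the fact itself) unconditionally.
[cite: GreenbergLNM1716, Thm. 4.1 (p. 102), §4 p. 104, Lemmas 4.6–4.7 (pp. 105–108)] -/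
theorem greenberg_charValue_rankZero_of_lemma46_torsion
    (h46 : ∀ (W : WeierstrassCurve ℚ) [W.IsElliptic] [W.IsGloballyMinimal] (p : ℕ) [Fact p.Prime],
      GoodOrd W p → Nat.card (AddCommGroup.primaryComponent W.toAffine.Point p) ≠ 1 →
      ∀ κ : ZpExtension ℚ p, κ.IsCyclotomic → Finite (W.selmerGroupPInfty p) →
      ∃ v₀ : HeightOneSpectrum (𝓞 ℚ), ((p : ℕ) : 𝓞 ℚ) ∉ v₀.asIdeal ∧ W.HasGoodReductionAt v₀ ∧
        ∀ z : discreteH1 (localSubgroup (⊤ : Subgroup (absoluteGaloisGroup ℚ)) (v₀.adicCompletion ℚ))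
          (localPoints W (v₀.adicCompletion ℚ)), (∃ k : ℕ, p ^ k • z = 0) →
        ∃ T : W.subgroupH1 p κ.kerSubgroup,
          (∀ v : HeightOneSpectrum (𝓞 ℚ), v ≠ v₀ → ∀ σ : absoluteGaloisGroup ℚ,
            W.conjH1 p κ.kerSubgroup σ T ∈ W.localKerOver p κ.kerSubgroup (v.adicCompletion ℚ)) ∧
          (∀ (w : InfinitePlace ℚ) (σ : absoluteGaloisGroup ℚ),
            W.conjH1 p κ.kerSubgroup σ T ∈ W.localKerOver p κ.kerSubgroup w.Completion) ∧
          ∀ σ : absoluteGaloisGroup ℚ,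
            W.localResOver p κ.kerSubgroup (v₀.adicCompletion ℚ) (W.conjH1 p κ.kerSubgroup σ T) =
              Literature.NumberTheory.EllipticCurves.resOfLe (localPoints W (v₀.adicCompletion ℚ))
                (Subgroup.comap_mono le_top :
                  localSubgroup κ.kerSubgroup (v₀.adicCompletion ℚ) ≤
                    localSubgroup (⊤ : Subgroup (absoluteGaloisGroup ℚ)) (v₀.adicCompletion ℚ)) z) :
    greenberg_charValue_rankZero := by
  refine greenberg_charValue_rankZero_of_lemma46 fun W _ _ p _ hgo κ hκ hSel ↦ ?_
  have hdec : (fun a b : ℚ => Classical.propDecidable (a = b)) = instDecidableEqRat := Subsingleton.elim _ _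
  by_cases hE : Nat.card (AddCommGroup.primaryComponent W.toAffine.Point p) = 1
  · haveI := hSel
    obtain ⟨S, v₀, hS, hv₀⟩ := exists_finset_place W p
    refine ⟨v₀, (hS v₀ hv₀).1, (hS v₀ hv₀).2, fun z hz ↦ ?_⟩
    exact exists_realizer_of_natCard_primaryComponent_eq_one W p κ (by rw [hdec]; exact hE) S hS v₀ hv₀ z hz
  · exact h46 W p hgo hE κ hκ hSel

end Summit.BirchSwinnertonDyer.BirchSwinnertonDyer.Theorems.TorsionEulerChar

end
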